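import Summits.QuantumFields.BalabanUV.Beta.D1BFx.TwoPointEnds
import Summits.QuantumFields.BalabanUV.Beta.D1BFx.BiBubbleTable

/-!
# `BalabanUV.Beta.D1BFx.GradedBiBubbleTerms` — road «BF-x» for binder row D1, «A3.c ∕ L-X TAILS» PART II (F3): a GRADED two-leg table UNFOLDED into
# elementary TWO-POINT terms — every vertex difference recorded as a syntactic unit step at ONE END of ONE leg (an3's `isO_bub` induction as an identity,
# two-point version of part (A) `GradedBubbleTerms`)

HONEST DEPENDENCY (page 1, mandatory): continuum YM on T⁴ ⇐ BetaPertH ∧ nine spine estimates (0/9 proved); BetaPertH ⇐ (D1) ∧ (D4) ∧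
CAP+tail; G-an2-4 gates asym, D1 and NE2/3/4.  HONEST FRAMING (cell contract, verbatim): «discharging `BetaPertH` makes Bałaban's UV
stability UNCONDITIONAL — a real constructive-QFT result; it is NOT the continuum limit and NOT the Clay problem.»  THIS MODULE DISCHARGES
NOTHING of the wall: DATA definitions with bodies ([our objects] `legOf` (a leg with pending end operations), the elementary two-point term `ETerm₂` with
`eval`∕`smul`∕`len`, `pairTerms`∕`baseTerms₂`) and [folklore] list bookkeeping over (F1) `TwoPointEnds`, (F2) `BiBubbleTable` and an3's
`GradedBubbles.Graded`.  No `Prop` minted, nothing cited, 0 sorry.  0 wall binders; NOT an A3.c row, NOT (K), NOT D1, NOT `BetaPertH`, NOT continuum,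
NOT Clay.

ABSOLUTE RULE (cell charter, verbatim): «No internally-minted statement may enter as a cited fact. Every hypothesis is either kernel-proved in
this package or a verbatim quotation of a PUBLISHED theorem with page reference. The manuscript(s) under audit are NOT citable for their own
disputed steps — they are the thing under adjudication; programme-internal (2001/route/tribunal) claims are never citable.»

WHY (owner d1-p2-g9 K-LOCAL-ROWS v0.1 «A3.c = the per-word EXPANSION of `biBubbleTable (legPiece r) (legPiece r′) SbT SbT μ ν (b+w) b` into
vertex-differentiated leg monomials»; RULING ρ-g9-32 «PART II instantiates (D) with the FLAT window grades of `legPiece 1∕2`»).  The 8 L-BUB words have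
legs `diagPart Ga − frozenLeg gfrz`, `offPart Ga` — neither translation invariant nor fibre diagonal — so part (A)'s one-variable unfolding does not
apply.  In `tr(A·V·B·W)` with `V` realised at `z` and `W` at `z'`, a located pair `(x_p, y_p, m_p) ∈ V` and `(x_q, y_q, m_q) ∈ W` contribute
`Σ_{a f f₁ f₂} m_p f₁ f · m_q f₂ a · A (z'+y_q) (z+x_p) a f₁ · B (z+y_p) (z'+x_q) f f₂`: a ROW move of `V` moves `A`'s SECOND argument, a COLUMN
move of `V` moves `B`'s FIRST argument, a ROW move of `W` moves `B`'s SECOND argument, a COLUMN move of `W` moves `A`'s FIRST argument.  With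
`z = b + w`, `z' = b` (the road's `baseKer … b w`) the `w`-dependence sits in `A`'s second and `B`'s first argument; the other two ends are STATIC.
* [our objects] `legOf`, `ETerm₂`, `ETerm₂.eval`∕`smul`∕`len`, `pairTerms`, `baseTerms₂`; [folklore] `legOf_nil`, `shRk_legOf`, `shLk_legOf`, `shRk_sub_legOf`,
  `shLk_sub_legOf`, `term₂_legOf_eq_sum`, `bub₂_legOf_eq_sum`, `exists_eterms₂_right`, **`exists_eterms₂_of_graded`**: `Graded n₁ V → Graded n₂ W →
  ∃ Lst, (∀ t ∈ Lst, unit steps ∧ n₁ + n₂ ≤ t.len) ∧ ∀ A B z z', bub₂ A B z z' V W = Σ_{t ∈ Lst} t.eval A B z z'`.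
Unit `b2b-balaban-beta-d1-formalise-leaf-03` (gen 12), D1 formalisation swarm; `LEAVES-BFx.md` row «A3.c ∕ L-X TAILS» PART II (F3).
-/

noncomputable section

namespace Summit.QuantumFields.BalabanUV.Beta.D1BFx.GradedBiBubbleTerms

open Finset
open scoped BigOperators
open Literature.MathematicalPhysics.QuantumFieldTheory.Balaban1983to89.Beta
open ExpKernelCalculus (Site MKer)
open DyadicShell (Pt)
open GradedBubbles (LP Stn rowSh colSh smulS rowDiff colDiff Graded IsStep)
open TwoPointEnds (itL itR itL_diffR itR_diffR itL_diffL)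
open BiBubbleTable (term₂ bubRow₂ bub₂ shRk shLk bub₂_rowSh_left bub₂_colSh_left bub₂_rowSh_right bub₂_colSh_right bub₂_rowDiff_left bub₂_colDiff_left
  bub₂_rowDiff_right bub₂_colDiff_right bub₂_append_left bub₂_append_right bub₂_smul_left bub₂_smul_right)

/-! ## §1 Elementary two-point terms and the unfolding of a graded two-leg table -/

section Legs

variable {I : Type*}

/-- [our object] **A LEG WITH PENDING END OPERATIONS**: every fibre entry `(a, b)` of `A`, first argument translated by `cL` then differenced along `sL`,
second argument translated by `cR` then differenced along `sR`. -/
def legOf (A : MKer 4 I) (cL cR : Pt) (sL sR : List Pt) : MKer 4 I :=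
  fun x y a b => itL sL (itR sR (fun x y => A x y a b)) (x + cL) (y + cR)

/-- [folklore] No pending operation: the leg itself. -/
theorem legOf_nil (A : MKer 4 I) : legOf A 0 0 [] [] = A := by
  funext x y a b; simp [legOf, itL, itR]

/-- [folklore] A shift of the second argument is absorbed in `cR`. -/
theorem shRk_legOf (A : MKer 4 I) (cL cR : Pt) (sL sR : List Pt) (e : Pt) : shRk e (legOf A cL cR sL sR) = legOf A cL (e + cR) sL sR := by
  funext x y a b; simp only [shRk, legOf, add_assoc]

/-- [folklore] A shift of the first argument is absorbed in `cL`. -/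
theorem shLk_legOf (A : MKer 4 I) (cL cR : Pt) (sL sR : List Pt) (e : Pt) : shLk e (legOf A cL cR sL sR) = legOf A (e + cL) cR sL sR := by
  funext x y a b; simp only [shLk, legOf, add_assoc]

/-- [folklore] A difference of the second argument is one more step in `sR`. -/
theorem shRk_sub_legOf (A : MKer 4 I) (cL cR : Pt) (sL sR : List Pt) (e : Pt) :
    shRk e (legOf A cL cR sL sR) - legOf A cL cR sL sR = legOf A cL cR sL (e :: sR) := by
  funext x y a b
  simp only [Pi.sub_apply, shRk, legOf]
  have h1 := congrFun (congrFun (itL_diffR sL e (itR sR (fun x y => A x y a b))) (x + cL)) (y + cR)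
  have h2 := itR_diffR sR e (fun x y => A x y a b)
  rw [add_right_comm y e cR, h1, h2]

/-- [folklore] A difference of the first argument is one more step in `sL`. -/
theorem shLk_sub_legOf (A : MKer 4 I) (cL cR : Pt) (sL sR : List Pt) (e : Pt) :
    shLk e (legOf A cL cR sL sR) - legOf A cL cR sL sR = legOf A cL cR (e :: sL) sR := by
  funext x y a b
  simp only [Pi.sub_apply, shLk, legOf]
  have h1 := congrFun (congrFun (itL_diffL sL e (itR sR (fun x y => A x y a b))) (x + cL)) (y + cR)
  rw [add_right_comm x e cL, h1]

/-- [our object] **AN ELEMENTARY TWO-POINT TERM**: coefficient `c`, the fibre entry `(a, f₁)` of the first leg read at `(z' + uA, z + vA)` after the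
end steps `sA` (first ∕ static argument) and `dA` (second argument), and the fibre entry `(f, f₂)` of the second leg read at `(z + uB, z' + vB)` after
the end steps `dB` (first argument) and `sB` (second ∕ static argument).  DATA; asserts nothing. -/
structure ETerm₂ (I : Type*) where
  /-- coefficient -/
  c : ℝ
  /-- row fibre index of the first-leg entry -/
  a : I
  /-- column fibre index of the first-leg entry -/
  f₁ : I
  /-- row fibre index of the second-leg entry -/
  f : I
  /-- column fibre index of the second-leg entry -/
  f₂ : I
  /-- first-leg first-argument offset (from the second base point) -/
  uA : Pt
  /-- first-leg second-argument offset (from the first base point) -/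
  vA : Pt
  /-- second-leg first-argument offset (from the first base point) -/
  uB : Pt
  /-- second-leg second-argument offset (from the second base point) -/
  vB : Pt
  /-- steps on the first leg's first argument -/
  sA : List Pt
  /-- steps on the first leg's second argument -/
  dA : List Pt
  /-- steps on the second leg's first argument -/
  dB : List Pt
  /-- steps on the second leg's second argument -/
  sB : List Pt

namespace ETerm₂

/-- [our object] The value of an elementary two-point term through the legs `A, B` with the first vertex at `z`, the second at `z'`. -/
def eval (A B : MKer 4 I) (z z' : Pt) (t : ETerm₂ I) : ℝ :=
  t.c * itL t.sA (itR t.dA (fun x y => A x y t.a t.f₁)) (z' + t.uA) (z + t.vA) * itL t.dB (itR t.sB (fun x y => B x y t.f t.f₂)) (z + t.uB) (z' + t.vB)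

/-- [our object] Scalar multiple. -/
def smul (r : ℝ) (t : ETerm₂ I) : ETerm₂ I := { t with c := r * t.c }

/-- [our object] Total number of steps. -/
def len (t : ETerm₂ I) : ℕ := t.sA.length + t.dA.length + t.dB.length + t.sB.length

/-- [folklore] `eval` of a scalar multiple. -/
theorem eval_smul (r : ℝ) (A B : MKer 4 I) (z z' : Pt) (t : ETerm₂ I) : (t.smul r).eval A B z z' = r * t.eval A B z z' := by
  simp only [eval, smul]; ring

/-- [folklore] `smul` keeps the length. -/
theorem len_smul (r : ℝ) (t : ETerm₂ I) : (t.smul r).len = t.len := rfl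

end ETerm₂

/-- [folklore] Sum of `eval`s over a mapped list of scalar multiples. -/
theorem sum_map_eval_smul (r : ℝ) (A B : MKer 4 I) (z z' : Pt) (Lst : List (ETerm₂ I)) :
    ((Lst.map (ETerm₂.smul r)).map (ETerm₂.eval A B z z')).sum = r * (Lst.map (ETerm₂.eval A B z z')).sum := by
  rw [List.map_map, ← List.sum_map_mul_left]
  congr 1
  exact List.map_congr_left fun t _ => ETerm₂.eval_smul r A B z z' t

end Legs

section Terms

variable {I : Type*} [Fintype I]

/-- [our object] The elementary terms of ONE PAIR AGAINST ONE PAIR through legs with pending operations: one term per fibre quadruple. -/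
def pairTerms (cLA cRA cLB cRB : Pt) (sA dA dB sB : List Pt) (p q : LP I) : List (ETerm₂ I) :=
  (Finset.univ : Finset (I × I × I × I)).toList.map fun k =>
    ⟨p.m k.2.2.1 k.2.1 * q.m k.2.2.2 k.1, k.1, k.2.2.1, k.2.1, k.2.2.2, q.y + cLA, p.x + cRA, p.y + cLB, q.x + cRB, sA, dA, dB, sB⟩

/-- [folklore] `term₂` through legs with pending operations is the sum of its `pairTerms`. -/
theorem term₂_legOf_eq_sum (A B : MKer 4 I) (z z' : Pt) (cLA cRA cLB cRB : Pt) (sA dA dB sB : List Pt) (p q : LP I) :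
    term₂ (legOf A cLA cRA sA dA) (legOf B cLB cRB dB sB) z z' p q = ((pairTerms cLA cRA cLB cRB sA dA dB sB p q).map (ETerm₂.eval A B z z')).sum := by
  rw [pairTerms, List.map_map, Finset.sum_map_toList, term₂]
  rw [Fintype.sum_prod_type]
  refine sum_congr rfl fun a _ => ?_
  rw [Fintype.sum_prod_type]
  refine sum_congr rfl fun f _ => ?_
  rw [Fintype.sum_prod_type]
  refine sum_congr rfl fun f₁ _ => sum_congr rfl fun f₂ _ => ?_
  simp only [Function.comp_apply, ETerm₂.eval, legOf, add_assoc]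

/-- [folklore] The steps and lengths of the pair terms. -/
theorem mem_pairTerms {cLA cRA cLB cRB : Pt} {sA dA dB sB : List Pt} {p q : LP I} {t : ETerm₂ I}
    (ht : t ∈ pairTerms cLA cRA cLB cRB sA dA dB sB p q) : t.sA = sA ∧ t.dA = dA ∧ t.dB = dB ∧ t.sB = sB := by
  simp only [pairTerms, List.mem_map] at ht
  obtain ⟨k, -, rfl⟩ := ht
  exact ⟨rfl, rfl, rfl, rfl⟩

/-- [our object] The elementary terms of two RAW lists through legs with pending operations. -/
def baseTerms₂ (cLA cRA cLB cRB : Pt) (sA dA dB sB : List Pt) (V W : Stn I) : List (ETerm₂ I) :=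
  V.flatMap fun p => W.flatMap fun q => pairTerms cLA cRA cLB cRB sA dA dB sB p q

/-- [folklore] The two-leg table of two raw lists through legs with pending operations, unfolded. -/
theorem bub₂_legOf_eq_sum (A B : MKer 4 I) (z z' : Pt) (cLA cRA cLB cRB : Pt) (sA dA dB sB : List Pt) (V W : Stn I) :
    bub₂ (legOf A cLA cRA sA dA) (legOf B cLB cRB dB sB) z z' V W = ((baseTerms₂ cLA cRA cLB cRB sA dA dB sB V W).map (ETerm₂.eval A B z z')).sum := by
  induction V with
  | nil => rfl
  | cons p V ih =>
      have hrow : ∀ W : Stn I, bubRow₂ (legOf A cLA cRA sA dA) (legOf B cLB cRB dB sB) z z' p W =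
          ((W.flatMap fun q => pairTerms cLA cRA cLB cRB sA dA dB sB p q).map (ETerm₂.eval A B z z')).sum := by
        intro W
        induction W with
        | nil => rfl
        | cons q W ihW => rw [bubRow₂, ihW, List.flatMap_cons, List.map_append, List.sum_append, term₂_legOf_eq_sum]
      simp only [baseTerms₂, List.flatMap_cons, List.map_append, List.sum_append] at ih ⊢
      rw [bub₂, ih, hrow]

/-- [folklore] Members of `baseTerms₂` carry exactly the given steps. -/
theorem mem_baseTerms₂ {cLA cRA cLB cRB : Pt} {sA dA dB sB : List Pt} {V W : Stn I} {t : ETerm₂ I}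
    (ht : t ∈ baseTerms₂ cLA cRA cLB cRB sA dA dB sB V W) : t.sA = sA ∧ t.dA = dA ∧ t.dB = dB ∧ t.sB = sB := by
  simp only [baseTerms₂, List.mem_flatMap] at ht
  obtain ⟨p, -, q, -, hq⟩ := ht
  exact mem_pairTerms hq

/-- [folklore] **THE UNFOLDING WITH THE SECOND VERTEX GRADED** (inner induction; raw first list, pending leg operations). -/
theorem exists_eterms₂_right (V : Stn I) {n₂ : ℕ} {W : Stn I} (hW : Graded n₂ W) :
    ∀ (cLA cRA cLB cRB : Pt) (sA dA dB sB : List Pt), (∀ e ∈ sA ++ dA ++ dB ++ sB, IsStep e) →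
      ∃ Lst : List (ETerm₂ I), (∀ t ∈ Lst, (∀ e ∈ t.sA ++ t.dA ++ t.dB ++ t.sB, IsStep e) ∧ n₂ + (sA.length + dA.length + dB.length + sB.length) ≤ t.len) ∧
        ∀ (A B : MKer 4 I) (z z' : Pt), bub₂ (legOf A cLA cRA sA dA) (legOf B cLB cRB dB sB) z z' V W = (Lst.map (ETerm₂.eval A B z z')).sum := by
  induction hW with
  | zero W =>
      intro cLA cRA cLB cRB sA dA dB sB hs
      refine ⟨baseTerms₂ cLA cRA cLB cRB sA dA dB sB V W, fun t ht => ?_, fun A B z z' => bub₂_legOf_eq_sum A B z z' cLA cRA cLB cRB sA dA dB sB V W⟩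
      obtain ⟨e₁, e₂, e₃, e₄⟩ := mem_baseTerms₂ ht
      refine ⟨fun e he => hs e (by rw [e₁, e₂, e₃, e₄] at he; exact he), by simp only [ETerm₂.len, e₁, e₂, e₃, e₄]; omega⟩
  | weaken _ ih =>
      intro cLA cRA cLB cRB sA dA dB sB hs
      obtain ⟨Lst, hL, hid⟩ := ih cLA cRA cLB cRB sA dA dB sB hs
      exact ⟨Lst, fun t ht => ⟨(hL t ht).1, by have := (hL t ht).2; omega⟩, hid⟩
  | @rowDiff n W e he _ ih =>
      -- row of the second vertex ⇒ the second leg's SECOND argument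
      intro cLA cRA cLB cRB sA dA dB sB hs
      obtain ⟨Lst, hL, hid⟩ := ih cLA cRA cLB cRB sA dA dB (e :: sB) (fun e' he' => by
        simp only [List.mem_append, List.mem_cons] at he' hs ⊢
        rcases he' with ((h | h) | h) | h | h
        · exact hs e' (Or.inl (Or.inl (Or.inl h)))
        · exact hs e' (Or.inl (Or.inl (Or.inr h)))
        · exact hs e' (Or.inl (Or.inr h))
        · rw [h]; exact he
        · exact hs e' (Or.inr h))
      refine ⟨Lst, fun t ht => ⟨(hL t ht).1, by have := (hL t ht).2; simp only [List.length_cons] at this; omega⟩, fun A B z z' => ?_⟩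
      rw [bub₂_rowDiff_right, shRk_sub_legOf]
      exact hid A B z z'
  | @colDiff n W e he _ ih =>
      -- column of the second vertex ⇒ the first leg's FIRST argument
      intro cLA cRA cLB cRB sA dA dB sB hs
      obtain ⟨Lst, hL, hid⟩ := ih cLA cRA cLB cRB (e :: sA) dA dB sB (fun e' he' => by
        simp only [List.mem_append, List.mem_cons] at he' hs ⊢
        rcases he' with (((h | h) | h) | h) | h
        · rw [h]; exact he
        · exact hs e' (Or.inl (Or.inl (Or.inl h)))
        · exact hs e' (Or.inl (Or.inl (Or.inr h)))
        · exact hs e' (Or.inl (Or.inr h))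
        · exact hs e' (Or.inr h))
      refine ⟨Lst, fun t ht => ⟨(hL t ht).1, by have := (hL t ht).2; simp only [List.length_cons] at this; omega⟩, fun A B z z' => ?_⟩
      rw [bub₂_colDiff_right, shLk_sub_legOf]
      exact hid A B z z'
  | @rowSh n W e _ ih =>
      intro cLA cRA cLB cRB sA dA dB sB hs
      obtain ⟨Lst, hL, hid⟩ := ih cLA cRA cLB (e + cRB) sA dA dB sB hs
      refine ⟨Lst, hL, fun A B z z' => ?_⟩
      rw [bub₂_rowSh_right, shRk_legOf]
      exact hid A B z z'
  | @colSh n W e _ ih =>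
      intro cLA cRA cLB cRB sA dA dB sB hs
      obtain ⟨Lst, hL, hid⟩ := ih (e + cLA) cRA cLB cRB sA dA dB sB hs
      refine ⟨Lst, hL, fun A B z z' => ?_⟩
      rw [bub₂_colSh_right, shLk_legOf]
      exact hid A B z z'
  | @append n W W' _ _ ih ih' =>
      intro cLA cRA cLB cRB sA dA dB sB hs
      obtain ⟨Lst, hL, hid⟩ := ih cLA cRA cLB cRB sA dA dB sB hs
      obtain ⟨Lst', hL', hid'⟩ := ih' cLA cRA cLB cRB sA dA dB sB hs
      refine ⟨Lst ++ Lst', fun t ht => ?_, fun A B z z' => ?_⟩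
      · rcases List.mem_append.mp ht with ht | ht
        · exact hL t ht
        · exact hL' t ht
      · rw [bub₂_append_right, hid, hid', List.map_append, List.sum_append]
  | @smul n W r _ ih =>
      intro cLA cRA cLB cRB sA dA dB sB hs
      obtain ⟨Lst, hL, hid⟩ := ih cLA cRA cLB cRB sA dA dB sB hs
      refine ⟨Lst.map (ETerm₂.smul r), fun t ht => ?_, fun A B z z' => ?_⟩
      · obtain ⟨t', ht', rfl⟩ := List.mem_map.mp ht
        exact ⟨(hL t' ht').1, by rw [ETerm₂.len_smul]; exact (hL t' ht').2⟩
      · rw [bub₂_smul_right, hid, sum_map_eval_smul]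

/-- [folklore] **THE UNFOLDING WITH BOTH VERTICES GRADED** (outer induction). -/
theorem exists_eterms₂_aux {n₁ : ℕ} {V : Stn I} (hV : Graded n₁ V) :
    ∀ {n₂ : ℕ} {W : Stn I}, Graded n₂ W → ∀ (cLA cRA cLB cRB : Pt) (sA dA dB sB : List Pt), (∀ e ∈ sA ++ dA ++ dB ++ sB, IsStep e) →
      ∃ Lst : List (ETerm₂ I), (∀ t ∈ Lst, (∀ e ∈ t.sA ++ t.dA ++ t.dB ++ t.sB, IsStep e) ∧
          n₁ + n₂ + (sA.length + dA.length + dB.length + sB.length) ≤ t.len) ∧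
        ∀ (A B : MKer 4 I) (z z' : Pt), bub₂ (legOf A cLA cRA sA dA) (legOf B cLB cRB dB sB) z z' V W = (Lst.map (ETerm₂.eval A B z z')).sum := by
  induction hV with
  | zero V =>
      intro n₂ W hW cLA cRA cLB cRB sA dA dB sB hs
      obtain ⟨Lst, hL, hid⟩ := exists_eterms₂_right V hW cLA cRA cLB cRB sA dA dB sB hs
      exact ⟨Lst, fun t ht => ⟨(hL t ht).1, by have := (hL t ht).2; omega⟩, hid⟩
  | weaken _ ih =>
      intro n₂ W hW cLA cRA cLB cRB sA dA dB sB hs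
      obtain ⟨Lst, hL, hid⟩ := ih hW cLA cRA cLB cRB sA dA dB sB hs
      exact ⟨Lst, fun t ht => ⟨(hL t ht).1, by have := (hL t ht).2; omega⟩, hid⟩
  | @rowDiff n V e he _ ih =>
      -- row of the first vertex ⇒ the first leg's SECOND argument
      intro n₂ W hW cLA cRA cLB cRB sA dA dB sB hs
      obtain ⟨Lst, hL, hid⟩ := ih hW cLA cRA cLB cRB sA (e :: dA) dB sB (fun e' he' => by
        simp only [List.mem_append, List.mem_cons] at he' hs ⊢
        rcases he' with ((h | h | h) | h) | h
        · exact hs e' (Or.inl (Or.inl (Or.inl h)))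
        · rw [h]; exact he
        · exact hs e' (Or.inl (Or.inl (Or.inr h)))
        · exact hs e' (Or.inl (Or.inr h))
        · exact hs e' (Or.inr h))
      refine ⟨Lst, fun t ht => ⟨(hL t ht).1, by have := (hL t ht).2; simp only [List.length_cons] at this; omega⟩, fun A B z z' => ?_⟩
      rw [bub₂_rowDiff_left, shRk_sub_legOf]
      exact hid A B z z'
  | @colDiff n V e he _ ih =>
      -- column of the first vertex ⇒ the second leg's FIRST argument
      intro n₂ W hW cLA cRA cLB cRB sA dA dB sB hs
      obtain ⟨Lst, hL, hid⟩ := ih hW cLA cRA cLB cRB sA dA (e :: dB) sB (fun e' he' => by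
        simp only [List.mem_append, List.mem_cons] at he' hs ⊢
        rcases he' with ((h | h) | h | h) | h
        · exact hs e' (Or.inl (Or.inl (Or.inl h)))
        · exact hs e' (Or.inl (Or.inl (Or.inr h)))
        · rw [h]; exact he
        · exact hs e' (Or.inl (Or.inr h))
        · exact hs e' (Or.inr h))
      refine ⟨Lst, fun t ht => ⟨(hL t ht).1, by have := (hL t ht).2; simp only [List.length_cons] at this; omega⟩, fun A B z z' => ?_⟩
      rw [bub₂_colDiff_left, shLk_sub_legOf]
      exact hid A B z z'
  | @rowSh n V e _ ih =>
      intro n₂ W hW cLA cRA cLB cRB sA dA dB sB hs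
      obtain ⟨Lst, hL, hid⟩ := ih hW cLA (e + cRA) cLB cRB sA dA dB sB hs
      refine ⟨Lst, hL, fun A B z z' => ?_⟩
      rw [bub₂_rowSh_left, shRk_legOf]
      exact hid A B z z'
  | @colSh n V e _ ih =>
      intro n₂ W hW cLA cRA cLB cRB sA dA dB sB hs
      obtain ⟨Lst, hL, hid⟩ := ih hW cLA cRA (e + cLB) cRB sA dA dB sB hs
      refine ⟨Lst, hL, fun A B z z' => ?_⟩
      rw [bub₂_colSh_left, shLk_legOf]
      exact hid A B z z'
  | @append n V V' _ _ ih ih' =>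
      intro n₂ W hW cLA cRA cLB cRB sA dA dB sB hs
      obtain ⟨Lst, hL, hid⟩ := ih hW cLA cRA cLB cRB sA dA dB sB hs
      obtain ⟨Lst', hL', hid'⟩ := ih' hW cLA cRA cLB cRB sA dA dB sB hs
      refine ⟨Lst ++ Lst', fun t ht => ?_, fun A B z z' => ?_⟩
      · rcases List.mem_append.mp ht with ht | ht
        · exact hL t ht
        · exact hL' t ht
      · rw [bub₂_append_left, hid, hid', List.map_append, List.sum_append]
  | @smul n V r _ ih =>
      intro n₂ W hW cLA cRA cLB cRB sA dA dB sB hs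
      obtain ⟨Lst, hL, hid⟩ := ih hW cLA cRA cLB cRB sA dA dB sB hs
      refine ⟨Lst.map (ETerm₂.smul r), fun t ht => ?_, fun A B z z' => ?_⟩
      · obtain ⟨t', ht', rfl⟩ := List.mem_map.mp ht
        exact ⟨(hL t' ht').1, by rw [ETerm₂.len_smul]; exact (hL t' ht').2⟩
      · rw [bub₂_smul_left, hid, sum_map_eval_smul]

/-- [folklore] **THE UNFOLDING OF A GRADED TWO-LEG TABLE INTO ELEMENTARY TWO-POINT TERMS.**  For `Graded n₁ V`, `Graded n₂ W` there is a finite list —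
depending on `V`, `W` only — of elementary two-point terms with unit steps of total number `≥ n₁ + n₂`, with
`bub₂ A B z z' V W = Σ_t t.eval A B z z'` for ALL legs `A, B` and all base points (combine with `biBubble_realK_realK`). -/
theorem exists_eterms₂_of_graded {n₁ : ℕ} {V : Stn I} (hV : Graded n₁ V) {n₂ : ℕ} {W : Stn I} (hW : Graded n₂ W) :
    ∃ Lst : List (ETerm₂ I), (∀ t ∈ Lst, (∀ e ∈ t.sA ++ t.dA ++ t.dB ++ t.sB, IsStep e) ∧ n₁ + n₂ ≤ t.len) ∧
      ∀ (A B : MKer 4 I) (z z' : Pt), bub₂ A B z z' V W = (Lst.map (ETerm₂.eval A B z z')).sum := by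
  obtain ⟨Lst, hL, hid⟩ := exists_eterms₂_aux hV hW 0 0 0 0 [] [] [] [] (by simp)
  refine ⟨Lst, fun t ht => ⟨(hL t ht).1, by simpa using (hL t ht).2⟩, fun A B z z' => ?_⟩
  have h := hid A B z z'
  rwa [legOf_nil, legOf_nil] at h

end Terms

end Summit.QuantumFields.BalabanUV.Beta.D1BFx.GradedBiBubbleTerms

end
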